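import Literature.Computability.QuantumComplexity.ForrelationThm25Reduction
import Literature.Computability.QuantumComplexity.QSimSignLift
import Literature.Computability.QuantumComplexity.QSimSignProofs
import Literature.Computability.Cryptography.ClassBQPReductionProofs
import HarnessLib

/-!
# Aaronson–Ambainis Lemma 24, membership half over `{H, CCSIGN}`: reduction to the membership of FORRELATION

Topic `Literature/Computability/QuantumComplexity`; sibling proof file (theorems only) of
`ForrelationCompleteProofs.lean`, whose named fact `AaronsonAmbainis2018_lemma24_mem`
(`qSimProblem ∈ PromiseBQP`: QSIM over `{H, CCSIGN}`, `A_Q ≥ 3/5` versus `|A_Q| ≤ 1/100`, is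
decided by a `TM2`-uniform Clifford+`T` family) is the membership half of S. Aaronson,
A. Ambainis, *Forrelation*, SIAM J. Comput. 47 (2018) = arXiv:1411.5729, §6, Lemma 24 (p. 26 of the
arXiv version: "QSIM is `PromiseBQP`-complete [follows from Shi]"; printed proof of membership:
"what was said above … together with standard amplification").

In the tree's model a uniform family reads the *code* of `Q` on its input wires, so "simulate `Q`"
is a programmable-circuit statement; the tree obtains it through the paper's own §6 from three
results, all discharged:

1. `AaronsonAmbainis2018_thm25_holds` (`ForrelationThm25Reduction.lean`, PROVED): QSIM over
   `{H, CCSIGN}` Karp-reduces to explicit `k`-fold FORRELATION (Thm. 25; through QSIM over the sign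
   basis, `qSimProblem_reducible_qSimSignProblem`, and `AaronsonAmbainis2018_thm25_sign_holds`);
2. `Cryptography.mem_PromiseBQP_of_polyTimeReducible` (`ClassBQPReductionProofs.lean`, PROVED):
   `PromiseBQP` is closed downwards under Karp reductions of promise problems;
3. `AaronsonAmbainis2018_kForrelation_mem_holds` (`ForrelationMemValue.lean`, PROVED):
   `kForrelationProblem ∈ PromiseBQP` (p. 26 via Prop. 6).

Hence `AaronsonAmbainis2018_lemma24_mem_of_kForrelation_mem`, and the closed discharge
`AaronsonAmbainis2018_lemma24_mem_holds` is its application to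
`AaronsonAmbainis2018_kForrelation_mem_holds`. Also recorded:
the two QSIMs are in `PromiseBQP` together (`AaronsonAmbainis2018_lemma24_mem_iff_sign_mem`, from
the two exact reductions `qSimProblem_reducible_qSimSignProblem` and
`qSimSign_polyTimeReducible_qSim` of the tree), and QSIM over `{H, CCSIGN}` is
`PromiseBQP`-complete given the two remaining named halves (`qSimProblem_complete_of`).

## References

* S. Aaronson, A. Ambainis, *Forrelation: a problem that optimally separates quantum from
  classical computing*, SIAM J. Comput. 47 (2018) 982–1038; arXiv:1411.5729, §6: Lemma 24 and its
  proof (p. 26), Prop. 6 (§3.2; "clearly in PromiseBQP", p. 26), Thm. 25 (p. 27).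
* J. Watrous, *Quantum computational complexity*, Springer 2009 (= arXiv:0804.3401), §II.1 (Karp
  reductions of promise problems), §IV.3–IV.4 (classical computation inside quantum circuit
  families; `BQP^BQP = BQP`).
* O. Goldreich, *On promise problems: a survey*, LNCS 3895 (2006), §1.2 Def. 3.
-/

namespace Literature.Computability.QuantumComplexity

open Cryptography Complexity

/-- **AA Lemma 24, membership half over `{H, CCSIGN}`, from the membership of FORRELATION.** If
explicit `k`-fold FORRELATION is in `PromiseBQP` (`AaronsonAmbainis2018_kForrelation_mem`), then
so is QSIM over `{H, CCSIGN}`: it Karp-reduces to FORRELATION by the discharged Theorem 25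
(`AaronsonAmbainis2018_thm25_holds`) and `PromiseBQP` is closed downwards under Karp reductions
(`mem_PromiseBQP_of_polyTimeReducible`). [cite: AaronsonAmbainis2018, §6 Lemma 24 (p. 26), with Prop. 6 and Thm. 25] -/
theorem AaronsonAmbainis2018_lemma24_mem_of_kForrelation_mem
    (hmem : AaronsonAmbainis2018_kForrelation_mem) : AaronsonAmbainis2018_lemma24_mem :=
  mem_PromiseBQP_of_polyTimeReducible AaronsonAmbainis2018_thm25_holds hmem

/-- The same from the vendored completeness statement `aaronson_ambainis_kForrelation_complete`
(whose first conjunct is the membership of FORRELATION). [cite: AaronsonAmbainis2018, §6 Lemma 24 (p. 26)] -/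
theorem AaronsonAmbainis2018_lemma24_mem_of_complete
    (h : aaronson_ambainis_kForrelation_complete) : AaronsonAmbainis2018_lemma24_mem :=
  AaronsonAmbainis2018_lemma24_mem_of_kForrelation_mem h.1

/-- **The two QSIMs are in `PromiseBQP` together**: QSIM over `{H, CCSIGN}` (`n` in binary) and
QSIM over the sign basis `{H, Z, CZ, CCZ}` (`n` in unary) are mutually Karp-reducible
(`qSimProblem_reducible_qSimSignProblem`, `qSimSign_polyTimeReducible_qSim`), so Lemma 24
(membership) holds for one iff for the other (`mem_PromiseBQP_iff_of_polyTimeReducible`).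
[cite: AaronsonAmbainis2018, §6 Lemma 24 (p. 26)] -/
theorem AaronsonAmbainis2018_lemma24_mem_iff_sign_mem :
    AaronsonAmbainis2018_lemma24_mem ↔ AaronsonAmbainis2018_lemma24_sign_mem :=
  mem_PromiseBQP_iff_of_polyTimeReducible qSimProblem_reducible_qSimSignProblem qSimSign_polyTimeReducible_qSim

/-- Lemma 24 (membership) over `{H, CCSIGN}` from Lemma 24 (membership) over the sign basis.
[cite: AaronsonAmbainis2018, §6 Lemma 24 (p. 26)] -/
theorem AaronsonAmbainis2018_lemma24_mem_of_sign_mem (h24 : AaronsonAmbainis2018_lemma24_sign_mem) :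
    AaronsonAmbainis2018_lemma24_mem :=
  AaronsonAmbainis2018_lemma24_mem_iff_sign_mem.2 h24

/-- **QSIM over `{H, CCSIGN}` is `PromiseBQP`-complete (AA Lemma 24 as printed), given its two
remaining named halves**: membership from FORRELATION's (`AaronsonAmbainis2018_kForrelation_mem`)
and hardness (`AaronsonAmbainis2018_lemma24_hard`). [cite: AaronsonAmbainis2018, §6 Lemma 24 (p. 26)] -/
theorem qSimProblem_complete_of (hmem : AaronsonAmbainis2018_kForrelation_mem)
    (h24 : AaronsonAmbainis2018_lemma24_hard) :
    qSimProblem ∈ PromiseBQP ∧ ∀ Q ∈ PromiseBQP, PromiseProblem.PolyTimeReducible Q qSimProblem :=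
  ⟨AaronsonAmbainis2018_lemma24_mem_of_kForrelation_mem hmem, h24⟩

/-- **DISCHARGE of `AaronsonAmbainis2018_lemma24_mem` (AA Lemma 24, membership half over
`{H, CCSIGN}`): QSIM over `{H, CCSIGN}` is in `PromiseBQP`.** The printed proof ("follows from what
was said above — i.e., the fact that `H` and CCSIGN are universal, and the Solovay–Kitaev Theorem —
together with standard amplification", p. 26) is realised in the tree's programmable-circuit model
along the paper's own §6: QSIM Karp-reduces to explicit `k`-fold FORRELATION by Theorem 25
(`AaronsonAmbainis2018_thm25_holds`), FORRELATION is in `PromiseBQP` by Prop. 6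
(`AaronsonAmbainis2018_kForrelation_mem_holds`), and `PromiseBQP` is closed downwards under Karp
reductions (`mem_PromiseBQP_of_polyTimeReducible`).
[cite: AaronsonAmbainis2018, §6 Lemma 24 (p. 26), with §3.2 Prop. 6 and §6 Thm. 25 (p. 27)] -/
theorem AaronsonAmbainis2018_lemma24_mem_holds : AaronsonAmbainis2018_lemma24_mem :=
  AaronsonAmbainis2018_lemma24_mem_of_kForrelation_mem AaronsonAmbainis2018_kForrelation_mem_holds

/-- **AA Lemma 24 over `{H, CCSIGN}` as printed (`PromiseBQP`-completeness of QSIM), from its one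
remaining named half**, the hardness `AaronsonAmbainis2018_lemma24_hard`; membership is now
`AaronsonAmbainis2018_lemma24_mem_holds`. [cite: AaronsonAmbainis2018, §6 Lemma 24 (p. 26)] -/
theorem qSimProblem_complete_of_hard (h24 : AaronsonAmbainis2018_lemma24_hard) :
    qSimProblem ∈ PromiseBQP ∧ ∀ Q ∈ PromiseBQP, PromiseProblem.PolyTimeReducible Q qSimProblem :=
  qSimProblem_complete_of AaronsonAmbainis2018_kForrelation_mem_holds h24

end Literature.Computability.QuantumComplexity
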